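import Summits.RiemannHypothesis.RiemannHypothesis.Theses.WeilWindowFlow
import Literature.NumberTheory.LFunctions.WeilMarkovQuadratic
import Literature.NumberTheory.LFunctions.WeilGroundState
import Literature.NumberTheory.LFunctions.WeilSemilocalCompactnessProofs
import HarnessLib.Audit

/-!
# Line `cut-dont-squeeze` — skeleton for crux `WeilWindowFlow.WindowLipschitz`
(item stmt-RiemannHypothesis-1039, route route-RiemannHypothesis-WeilWindowFlow; crux-plan round 1, rev 3 = gen 2; rev 4 = line lead's reshape, 2026-08-16)

Crux (BY NAME, never restated): `Summit.RiemannHypothesis.RiemannHypothesis.Theses.WeilWindowFlow.WindowLipschitz`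
= `∀ b₀ A, 0 < b₀ → b₀ ≤ A → ∃ L, ∀ b a, b₀ ≤ b → b ≤ a → a ≤ A → ε b − ε a ≤ L (a − b)`,
`ε = Literature.NumberTheory.LFunctions.weilGroundEnergy`.

## The line (idea card `Cruxes/WindowLipschitz/Ideas/cut-dont-squeeze.md`; triage r1 k1–k3: pass ×3; merged by the
panel with `ladder-edge-law-excision` ≈ `collar-cut-exit-time-edge-law`; edge engines = lines `ladder-height-edge-law`,
`borderline-barrier`)

CUT, DON'T SQUEEZE.  Compare the windows `a − h < a` by MULTIPLYING a TRUE ground state `u` of the big window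
(`IsWeilGroundState a u`; existence is the PROVED tree theorem
`ConnesConsaniMoscovici2025_thm_3_6_holds.exists_isWeilGroundState`, used in the glue) by a Lipschitz cutoff `χ`
(`= 1` on `|x| ≤ a − 2h`, `= 0` on `|x| ≥ a − h`, slope `1/h`), instead of dilating it (Bombieri 2000, Thm 5:
dilation moves every prime evaluation point and needs a virial at near-minimisers — the disprover's sorried
near-miss `not_virialBoundedOnNearMinimisers`).  In the CLOSED form
`𝔅_a(f) := P(f) + 𝓔_a(f) − (M_a + ε(a))‖f‖²` (pole form + pure-jump Dirichlet energy − killing: the tree's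
Markov decomposition `weilQuadratic_re_eq_weilPoleForm_add_weilDirichletEnergy_sub`, extended from test functions to
the form domain — Stub C1) the ground state sits at the bottom, `𝔅_a(u) = 0` (Stub C2), so the Euler–Lagrange
equation kills every cross term and the IMS localisation formula leaves only a COMMUTATOR (Stub D, the lever):
`(ε(a−h) − ε(a)) ‖χu‖² ≤ 𝔅_a((1−χ)u) ≤ ∬ (χ(x) − χ(y))² |u(x)||u(y)| ν_a(dx,dy) + (rank-2 polar remainder)`.
Under the uniform sup bound (Stub A) and the `L²` EDGE-MASS LAW `∫_{a−r<|x|} |u|² ≤ K r / log(1/r)`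
(Stub B — the bet of the line, its `C⁺`; boundary exponent exactly `1/2` in `L²`-average) the commutator is `≤ C·h`
uniformly on compact window ranges (Stub E: layer `L¹`-mass `O(h (log 1/h)^{-1/2})` times the dyadic-shell potential
of the bulk `O((log 1/h)^{+1/2})` — the two half-powers cancel exactly; no `log log` is lost because Cauchy–Schwarz
is applied shell by shell, not globally).  The sorry-free glue (`oneStep_of`, `lipschitzBound_of_oneStep`) builds the
cutoff, divides by `‖χu‖² ≥ 1/2`, and telescopes with the antitonicity of `ε` (proved here); `WindowLipschitz_of :
WindowLipschitz` applies it to the six stubs by name.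

## What changed in rev 3 (gen 2) against rev 2 (gen 1, same path)

* the bet is WEAKENED from the pointwise edge law (`‖u(x)‖² log(1/(a−|x|)) ≤ K` a.e.) to its `L²`-average, the
  edge-mass law (Stub B); Stub E is re-proved (on paper) from (A) + (B) by dyadic shells — so every engine for the
  pointwise law (lines `ladder-height-edge-law` / `borderline-barrier`, HS-LR-S arXiv:2401.18033, BGR15
  arXiv:1307.0270) still discharges (B) through the sorry-free bridge `edgeMassLaw_of_pointwise` below, and
  `L²`/form-level arguments become admissible too;
* the closed-form calculus is split into two independently provable stubs (C1: positivity of `𝔅_a` on the form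
  domain; C2: the ground state has finite energy and `𝔅_a(u) ≤ 0`), so that two workers can take them;
* `oneStep_of` takes only the two statements it uses ((D) and (E)); (A), (B), (C1), (C2) enter `WindowLipschitz_of`
  by name through (E) and (D).


## What changed in rev 4 (line lead prover-line-stmt-RiemannHypothesis-1039-0) against rev 3

* (A) `stub_supBound` now takes (C2) and the Euler–Lagrange identity (EL) as antecedents and carries an OPERATOR-FREE proof
  plan: the δ-decomposition maximum principle of Feulefack–Jarohs–Weth (arXiv:2010.10448 §3) — peel the far jumps
  `t > δ` off as `κ_δ⟨u,w⟩ − ⟨ρ1_{>δ} ⋆ u, w⟩` (`κ_δ = 2∫_δ^∞ρ → ∞`, the convolution is `L² → L^∞`) and test (EL) with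
  `(Re e^{-iθ}u − c)₊`; no semigroup / ultracontractivity is needed;
* new stub (EL) `stub_eulerLagrange : (C1) → (C2) → weak Euler–Lagrange identity` (borderline-barrier's `stub_weakEulerLagrange`
  conclusion), consumed by (A), (P) and (D) instead of being re-derived three times;
* the edge bet is registered in its POINTWISE form (P) `stub_edgeLaw : (C2) → (EL) → (A) → ‖u‖² log(1/d) ≤ K` (held by the lead;
  engine = borderline barrier + comparison, δ-localised), and rev 3's `L²` edge-mass law (B) is obtained from it by the sorry-free
  bridge `edgeMassLaw_of_pointwise`, so (E) `stub_commutatorBound : (A) → (B) → …` is kept VERBATIM;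
* (D) `stub_localizedCut` takes (EL) as a third antecedent (conclusion verbatim); (C1), (C2), (E) verbatim; glue untouched.

Registered stubs (7): `stub_formDomainPos` (C1, M) · `stub_groundStateEnergy` (C2, M) · `stub_eulerLagrange` (EL, M) ·
`stub_supBound` (A, M) · `stub_edgeLaw` (P, L — HARDEST, lead) · `stub_localizedCut` (D, M/L) · `stub_commutatorBound` (E, M/L).

## Registered stubs of rev 3 (6; every signature is written over EXISTING declarations only — no local `def`)

* `stub_supBound`          (A)  uniform `L^∞` bound of ground states on `[b₀, A]`                       — size L
* `stub_edgeMassLaw`       (B)  (A) → `L²` edge-mass law, rate `r/log(1/r)`, uniform on `[b₀, A]`       — size L, HARDEST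
* `stub_formDomainPos`     (C1) `𝔅_a ≥ 0` on the form domain of the window (density from inside/above)   — size M
* `stub_groundStateEnergy` (C2) a ground state has finite energy and `𝔅_a(u) ≤ 0` (Fatou along its sequence) — size M
* `stub_localizedCut`      (D)  (C1) → (C2) → localised cut inequality at a ground state (E–L + IMS + windows) — size M/L
* `stub_commutatorBound`   (E)  (A) → (B) → the right-hand side of (D) is `≤ C h` and `‖χu‖² ≥ 1/2` for every
                                admissible cutoff of width `h ≤ h₀`, uniformly on `[b₀, A]`                 — size M/L

Disproof.lean honoured (refuter-cdisprove-1039, evidence 2026-08-15T22:36Z; body read through its evidence notes —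
run/gate is not mounted in planner jails): the floor `0 < b₀` is USED in (A), (B), (E) and in the glue (`h ≤ b₀/2`;
constants blow up as `b₀ → 0⁺`: `‖u‖_∞ ≲ e^{tε(a)}`, `ε(a) ~ log(1/a)`) — `windowLipschitz_false_without_floor`,
`lipschitzConstant_unbounded`, `not_windowLipschitzUniform` respected; the glue is exactly the
"local-to-compact is free" remark of `windowLipschitz_iff_locallyLipschitzOn`; the sorried near-miss
`not_virialBoundedOnNearMinimisers` is AVOIDED: no virial, no derivative of any (near-)minimiser; only TRUE
ground states enter (A)–(E).  `ledger negatives --problem RiemannHypothesis`: none (2026-08-16); no landed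
`Theorems/…/Negative/` lemma exists for this crux.
-/

set_option linter.dupNamespace false

noncomputable section

open MeasureTheory Set Filter
open scoped Topology ENNReal NNReal

namespace Summit.RiemannHypothesis.RiemannHypothesis.Cruxes.WindowLipschitz.CutDontSqueeze

open Literature.NumberTheory.LFunctions
open Summit.RiemannHypothesis.RiemannHypothesis.Theses.WeilWindowFlow (WindowLipschitz)

/-! ### The seven registered stubs (rev 4: reshaped by the line lead 2026-08-16; same composition idea) -/

/-- **Stub C1 — positivity of the closed form on the form domain of the window** (size M).  Write
`𝔅_a(f) := weilPoleForm f + weilDirichletEnergy a f − (weilMarkovConstant a + ε(a)) ∫‖f‖²`; for TEST functions on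
the window this is `Re Q(f) − ε(a)‖f‖² ≥ 0` (tree: `weilQuadratic_re_eq_weilPoleForm_add_weilDirichletEnergy_sub`,
`weilGroundEnergy_mul_le_re`).  The stub extends `𝔅_a ≥ 0` to every `f ∈ L²` vanishing a.e. off `[−a, a]` with
finite archimedean energy — density FROM INSIDE by test functions: shrink `f_λ(x) = f(λx)` (`λ ↓ 1`, support in
`[−a/λ, a/λ]`), mollify at scale `δ < a(1 − 1/λ)` (a genuine test function on the window), use
`𝓔_a(f_λ ⋆ φ_δ) ≤ 𝓔_a(f_λ)` (Young / Jensen for each increment `D_t`, rates `≥ 0`), let `δ → 0` (pole form and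
`L²` norm continuous on the window), then `λ → 1`: `𝓔_a(f_λ) → 𝓔_a(f)` (`D_t(f_λ) = λ^{-1}D_{λt}(f)`; dominated
convergence in the jump length: `ρ = weilArchDensity` is decreasing, `ρ(s/λ) ≤ ρ(s/2) ≤ 3ρ(s) + 1` for `λ ≤ 2`,
and `D_s ≤ 4‖f‖²`; primes by `L²`-continuity of translations).  Indicator-type functions ARE in this log-order
form domain (`𝓔(1_{[−a,a]}) = ∫ρ · 2 min(t, 2a) < ∞`; no `H¹` vs `H¹₀` trap).
Sources: Bombieri2000Weil §4 (Problem 2, Thm 3); Chen–Fukushima 2012 §1.1 (closed Markovian forms);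
Feulefack–Jarohs–Weth arXiv:2010.10448 §3 p. 6 (`C²_c` dense in the form domain of the log-Laplacian); tree
`integrable_weilIncrement_integrand`, `weilDirichletEnergy_comp_le`, `weilIncrement_comp_le`.
Why it might fail: it does not in substance (standard closed-form calculus); the Lean risk is the
mollification bookkeeping (`MeasureTheory.convolution`, `ContDiffBump`). -/
theorem stub_formDomainPos :
    ∀ a : ℝ, 0 < a → ∀ f : ℝ → ℂ, MemLp f 2 → (∀ᵐ x : ℝ, x ∉ Icc (-a) a → f x = 0) →
      IntegrableOn (fun t ↦ weilArchDensity t * weilIncrement f t) (Ioi 0) →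
        (weilMarkovConstant a + weilGroundEnergy a) * ∫ x, ‖f x‖ ^ 2 ≤
          weilPoleForm f + weilDirichletEnergy a f := by
  sorry

/-- **Stub C2 — the ground state has finite energy and sits at the bottom** (size M).  A ground state `u` of the
window `a` (an `L²`-limit of a normalised minimising sequence `gₙ` of window tests, by DEFINITION of
`IsWeilGroundState`) has FINITE archimedean energy and `𝔅_a(u) ≤ 0`, i.e.
`P(u) + 𝓔_a(u) ≤ (M_a + ε(a)) ∫‖u‖²` (`= M_a + ε(a)`, `IsWeilGroundState.integral_norm_sq`).
Proof route: for tests, `Re Q(gₙ) = P(gₙ) + 𝓔_a(gₙ) − M_a → ε(a)` (tree identity + the defining limit);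
`P(gₙ) → P(u)` by continuity of the pole form on the window (`|∫ (gₙ − u) cosh| ≤ ‖gₙ − u‖₂ ‖cosh·1_{[−a,a]}‖₂`,
`IsWeilGroundState.ae_eq_zero_of_notMem`); `D_t(gₙ) → D_t(u)` for each `t` (`L²`-continuity of translations),
so the prime part converges and Fatou in the jump length (`lintegral_liminf_le`) bounds the archimedean part of
`u` by `liminf`, which also gives `IntegrableOn` (measurability: `t ↦ D_t(u)` is continuous).  With (C1): `𝔅_a(u) = 0`.
Sources: Bombieri2000Weil §4 Thm 3 (lower semicontinuity along the minimising sequence); tree `IsWeilGroundState`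
API, `integrableOn_weilArchDensity_mul_weilIncrement`.  Why it might fail: it does not (lsc of a closed form);
size is the Fatou/measurability bookkeeping. -/
theorem stub_groundStateEnergy :
    ∀ (a : ℝ) (u : ℝ → ℂ), IsWeilGroundState a u →
      IntegrableOn (fun t ↦ weilArchDensity t * weilIncrement u t) (Ioi 0) ∧
        weilPoleForm u + weilDirichletEnergy a u ≤
          (weilMarkovConstant a + weilGroundEnergy a) * ∫ x, ‖u x‖ ^ 2 := by
  sorry

/-- **Stub EL `stub_eulerLagrange` — the weak Euler–Lagrange identity of a ground state** (size M; Bombieri 2000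
Lemma 1 (4.2), `λ f = L[f]`, Markov-decomposed and operator-free; the statement is line `borderline-barrier`'s
`stub_weakEulerLagrange` conclusion with a.e. support conditions).  From (C1) and (C2): for a ground state `u` of window `a`
and every `w ∈ L²` vanishing a.e. off `[-a,a]` with finite archimedean energy,
`P(u,w) + Σ_{log n<2a} Λ(n)n^{-1/2} D_{log n}(u,w) + ∫₀^∞ ρ(t) D_t(u,w) dt − M_a⟨u,w⟩ = ε(a)⟨u,w⟩`, with the sesquilinear pole form
`P(u,w) = 2(∫u·ch)(∫w·ch)⁻ − 2(∫u·sh)(∫w·sh)⁻` (`ch = cosh(x/2)`, `sh = sinh(x/2)`), polarised increments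
`D_t(u,w) = ∫ (u(x+t) − u(x)) (w(x+t) − w(x))⁻ dx` (`|D_t(u,w)| ≤ √(D_t(u) D_t(w)) ≤ (D_t(u)+D_t(w))/2`, so `t ↦ ρ(t) D_t(u,w)` is
integrable on `(0,∞)` and the Bochner integral below is a genuine one) and `⟨u,w⟩ = ∫ u w̄`.
Proof: `q(v) := P(v) + 𝓔_a(v) − (M_a + ε(a))‖v‖²` is `≥ 0` on the finite-energy class of the window (C1) and `q(u) ≤ 0` (C2), hence
`q(u) = 0`; `u + s w` has finite energy (`D_t(u+sw) ≤ 2D_t(u) + 2s²D_t(w)`), and the real quadratic polynomial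
`s ↦ q(u + s w) = q(u) + 2s Re q(u,w) + s² q(w) ≥ 0` vanishing at `s = 0` has zero linear coefficient: `Re q(u,w) = 0`; repeat with
`i·w` for the imaginary part.  Sources: Bombieri2000Weil §4 Lemma 1 / Thm 3; tree `abs_polar_le`, `shiftedForm_add_le` (test-function
version of the PSD Cauchy–Schwarz), `integral_norm_sq_add_mul`, `tendsto_integral_mul_conj`.  Why it might fail: it does not (first
variation of a nonnegative quadratic form at a zero); size is the sesquilinear bookkeeping (integrability of every pairing). -/
theorem stub_eulerLagrange :
    (∀ a : ℝ, 0 < a → ∀ f : ℝ → ℂ, MemLp f 2 → (∀ᵐ x : ℝ, x ∉ Icc (-a) a → f x = 0) →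
      IntegrableOn (fun t ↦ weilArchDensity t * weilIncrement f t) (Ioi 0) →
        (weilMarkovConstant a + weilGroundEnergy a) * ∫ x, ‖f x‖ ^ 2 ≤
          weilPoleForm f + weilDirichletEnergy a f) →
    (∀ (a : ℝ) (u : ℝ → ℂ), IsWeilGroundState a u →
      IntegrableOn (fun t ↦ weilArchDensity t * weilIncrement u t) (Ioi 0) ∧
        weilPoleForm u + weilDirichletEnergy a u ≤
          (weilMarkovConstant a + weilGroundEnergy a) * ∫ x, ‖u x‖ ^ 2) →
    ∀ (a : ℝ) (u : ℝ → ℂ), IsWeilGroundState a u →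
      ∀ w : ℝ → ℂ, MemLp w 2 → (∀ᵐ x : ℝ, x ∉ Icc (-a) a → w x = 0) →
        IntegrableOn (fun t ↦ weilArchDensity t * weilIncrement w t) (Ioi 0) →
        2 * (∫ x, u x * (Real.cosh (x / 2) : ℂ)) * (starRingEnd ℂ) (∫ x, w x * (Real.cosh (x / 2) : ℂ))
          - 2 * (∫ x, u x * (Real.sinh (x / 2) : ℂ)) * (starRingEnd ℂ) (∫ x, w x * (Real.sinh (x / 2) : ℂ))
          + (∑ n ∈ weilPrimeIndex a, (((ArithmeticFunction.vonMangoldt n : ℝ) / Real.sqrt n : ℝ) : ℂ) *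
              ∫ x, (u (x + Real.log n) - u x) * (starRingEnd ℂ) (w (x + Real.log n) - w x))
          + (∫ t in Ioi (0 : ℝ), (weilArchDensity t : ℂ) *
              ∫ x, (u (x + t) - u x) * (starRingEnd ℂ) (w (x + t) - w x))
          - (weilMarkovConstant a : ℂ) * ∫ x, u x * (starRingEnd ℂ) (w x)
        = (weilGroundEnergy a : ℂ) * ∫ x, u x * (starRingEnd ℂ) (w x) := by
  sorry

/-- **Stub A `stub_supBound` — uniform `L^∞` bound of ground states on compact window ranges** (size M), from (C2)
(finite energy) and (EL), by the δ-DECOMPOSITION MAXIMUM PRINCIPLE of Feulefack–Jarohs–Weth (arXiv:2010.10448 §3, proof of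
Thm 3.1, there for `(−Δ)^s`, `s → 0⁺`, and for Dirichlet eigenfunctions of the logarithmic Laplacian) — NO semigroup, NO
operator, NO ultracontractivity (this replaces the planners' `e^{−tH}` route, for which Mathlib has no infrastructure).
Split the archimedean energy at jump length `δ`: `∫_δ^∞ ρ(t) D_t(u,w) dt = κ_δ ⟨u,w⟩ − ⟨U_δ, w⟩` with `κ_δ := 2∫_δ^∞ ρ`,
`U_δ(x) := ∫_{|t|>δ} ρ(|t|) u(x+t) dt`, `‖U_δ‖_∞ ≤ C_δ := (2∫_δ^∞ρ²)^{1/2} ‖u‖₂` (Cauchy–Schwarz; `ρ ≤ e^{t/2}/(2t)`,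
`weilArchDensity_le_exp_half_div`).  Since `ρ(t) ≥ e^{-t/2}/(2t)` (`exp_neg_half_div_le_weilArchDensity`), `κ_δ → +∞` as `δ → 0⁺`,
so there is `δ = δ(b₀,A) ≤ b₀` with `κ_δ ≥ M_A + ε(b₀) + 1 ≥ M_a + ε(a) + 1` for every `a ∈ [b₀,A]` (`M_a ≤ M_A`: `weilPrimeIndex`
is monotone in the window; `ε(a) ≤ ε(b₀)`: `ε` antitone, `weilGroundEnergy_antitone` below).  For `θ ∈ ℝ` put `u_θ := Re(e^{−iθ} u)`
((EL) for `u` and for `ū` — conjugate the identity tested with `w̄` — gives the REAL identity for `u_θ` against real `w`) and test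
with the truncation `w := (u_θ − c)₊`, `c > 0` (in `L²`, vanishes off the window, finite energy: a `1`-Lipschitz image of `u`,
`weilIncrement_comp_le`; `t ↦ D_t(w)` is continuous, hence measurable, for `w ∈ L²`).  The Markov inequality
`(p − q)((p−c)₊ − (q−c)₊) ≥ ((p−c)₊ − (q−c)₊)² ≥ 0` applied inside every prime increment and every `D_t`, `t ∈ (0,δ)`, and
`u_θ · w ≥ c · w ≥ 0` pointwise, turn (EL) into
`0 ≤ Σ_n Λ(n)n^{-1/2} D_{log n}(w) + ∫₀^δ ρ D_t(w) ≤ (M_a + ε(a) − κ_δ)·c·∫w + (C_δ + C_P)∫w ≤ (C_δ + C_P − c) ∫ w`,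
where `C_P = C_P(A)` bounds the pole vector `2(∫u_θ·ch)ch − 2(∫u_θ·sh)sh` on `[−A,A]` (`|∫u_θ ch| ≤ ‖u‖₂ ‖ch·1_{[−a,a]}‖₂`).
With `c := C_δ + C_P + 1` this forces `∫ w = 0`, i.e. `u_θ ≤ c` a.e.; `θ ∈ {0, π/2, π, 3π/2}` give `‖u‖ ≤ 2c` a.e., uniformly on
`[b₀, A]`.  The floor `0 < b₀` is load-bearing through `ε(b₀)` (`ε → +∞` at `0⁺`, disprover's `weilGroundEnergy_large_near_zero`,
`lipschitzConstant_unbounded`).  Model in print: FJW Thm 1.1 / Cor 1.4 (bounded Dirichlet eigenfunctions of `L_Δ`).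
Why it might fail: it does not in substance; the Lean size is the far/near split of the Bochner integral and the contraction
bookkeeping. -/
theorem stub_supBound :
    (∀ (a : ℝ) (u : ℝ → ℂ), IsWeilGroundState a u →
      IntegrableOn (fun t ↦ weilArchDensity t * weilIncrement u t) (Ioi 0) ∧
        weilPoleForm u + weilDirichletEnergy a u ≤
          (weilMarkovConstant a + weilGroundEnergy a) * ∫ x, ‖u x‖ ^ 2) →
    (∀ (a : ℝ) (u : ℝ → ℂ), IsWeilGroundState a u →
      ∀ w : ℝ → ℂ, MemLp w 2 → (∀ᵐ x : ℝ, x ∉ Icc (-a) a → w x = 0) →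
        IntegrableOn (fun t ↦ weilArchDensity t * weilIncrement w t) (Ioi 0) →
        2 * (∫ x, u x * (Real.cosh (x / 2) : ℂ)) * (starRingEnd ℂ) (∫ x, w x * (Real.cosh (x / 2) : ℂ))
          - 2 * (∫ x, u x * (Real.sinh (x / 2) : ℂ)) * (starRingEnd ℂ) (∫ x, w x * (Real.sinh (x / 2) : ℂ))
          + (∑ n ∈ weilPrimeIndex a, (((ArithmeticFunction.vonMangoldt n : ℝ) / Real.sqrt n : ℝ) : ℂ) *
              ∫ x, (u (x + Real.log n) - u x) * (starRingEnd ℂ) (w (x + Real.log n) - w x))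
          + (∫ t in Ioi (0 : ℝ), (weilArchDensity t : ℂ) *
              ∫ x, (u (x + t) - u x) * (starRingEnd ℂ) (w (x + t) - w x))
          - (weilMarkovConstant a : ℂ) * ∫ x, u x * (starRingEnd ℂ) (w x)
        = (weilGroundEnergy a : ℂ) * ∫ x, u x * (starRingEnd ℂ) (w x)) →
    ∀ b₀ A : ℝ, 0 < b₀ → b₀ ≤ A → ∃ K : ℝ, ∀ (a : ℝ) (u : ℝ → ℂ), b₀ ≤ a → a ≤ A →
      IsWeilGroundState a u → ∀ᵐ x : ℝ, ‖u x‖ ≤ K := by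
  sorry

/-- **Stub P `stub_edgeLaw` — the sharp POINTWISE edge law, exponent 1/2** (size L, the HARDEST; held by the line lead).
From (C2), (EL) and the sup bound (A): on every compact window range there are `K, d₀` with `‖u(x)‖² · log(1/(a − |x|)) ≤ K`
for a.e. `x` with `a − d₀ < |x| < a`, for every ground state `u` of every window `a ∈ [b₀, A]`; the `L²` edge-mass law (B) of
rev 3 follows by the sorry-free bridge `edgeMassLaw_of_pointwise` below.
Engine = line `borderline-barrier` (its `stub_barrierSurplus` + `stub_comparison`), δ-localised as in Stub A, architecture of
Hernández-Santamaría–López-Ríos–Saldaña arXiv:2401.18033 Thm 2.4 / Thm 1.1 (explicit 1-D barrier `(−log(x/2))^{-1/2}`, positive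
log-Laplacian near `0`, comparison near the boundary): with `W(d) := (log(1/min(d,d₀)))^{-1/2}` and the barrier
`B(x) := W(a − |x|)` on the window (`0` outside; `= β₀ := (log 1/d₀)^{-1/2}` on the plateau `a − |x| ≥ d₀`), the near-range
archimedean operator has a SURPLUS on the layer: for `a − d₀ < |y| < a` and `d₀ ≤ d₁(δ)`,
`∫_{|t|<δ} (B(y) − B(y+t)) ρ(|t|) dt ≥ ½√(log 1/d₀) − C(δ)` — the critical `½√(log 1/d)` of the outward killing `W(d)∫_d^δ ρ` and of
the inward pull `∫_d^{d₀}(W(t) − W(d)) dt/2t` cancel exactly (`ρ = 1/(2t) + ρ̃` with `0 ≤ ρ̃ ≤ 1/4` on `(0,δ)`; `W` concave increasing on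
`(0, e^{-3/2})`; `0 ≤ W(d+t) − W(t) ≤ C (log 1/t)^{-3/2}` for `t ≥ d`).  Comparison: `K₁ := C_sup √(log 1/d₀)` makes
`K₁ B ≥ C_sup ≥ u_θ` on the plateau (`u_θ := Re(e^{−iθ}u)`); test (EL) with `w := (u_θ − K₁B)₊` (supported in the layer; finite energy,
since `B·1_{[−a,a]}` has: `D_t(B·1) ≲ t/log(1/t)`), use `𝓔^δ(B·1, w) = ∫ w · L^δ B` (Fubini; `∫_layer |w| √(log 1/d) < ∞`), the prime
atoms `≥ −2S_A β₀` (`0 ≤ B ≤ β₀`), and the Markov inequality for `v = u_θ − K₁ B`: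
`0 ≤ 𝓔^δ(w,w) ≤ [C_δ + C_P + 2S_A β₀ K₁ − K₁(½√(log 1/d₀) − C(δ))] ∫ w < 0` unless `∫ w = 0`, once `log(1/d₀)` is large in terms of
`b₀, A` only.  Hence `|u_θ| ≤ K₁ B` for a countable dense set of `θ`, i.e. `‖u‖² log(1/(a−|x|)) ≤ 2 C_sup² log(1/d₀)` a.e. on the layer.
Numerics: kit j005651, `c² log(1/d)` flat down to `d = 1e-10`.  Why it might fail: the statement is the τ = ½ law every triager checked
(HS-LR-S Thm 1.2: ½ is optimal; FJW Rem 1.5: weaker methods stop at τ < ½); the risk is only the surplus-constant bookkeeping. -/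
theorem stub_edgeLaw :
    (∀ (a : ℝ) (u : ℝ → ℂ), IsWeilGroundState a u →
      IntegrableOn (fun t ↦ weilArchDensity t * weilIncrement u t) (Ioi 0) ∧
        weilPoleForm u + weilDirichletEnergy a u ≤
          (weilMarkovConstant a + weilGroundEnergy a) * ∫ x, ‖u x‖ ^ 2) →
    (∀ (a : ℝ) (u : ℝ → ℂ), IsWeilGroundState a u →
      ∀ w : ℝ → ℂ, MemLp w 2 → (∀ᵐ x : ℝ, x ∉ Icc (-a) a → w x = 0) →
        IntegrableOn (fun t ↦ weilArchDensity t * weilIncrement w t) (Ioi 0) →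
        2 * (∫ x, u x * (Real.cosh (x / 2) : ℂ)) * (starRingEnd ℂ) (∫ x, w x * (Real.cosh (x / 2) : ℂ))
          - 2 * (∫ x, u x * (Real.sinh (x / 2) : ℂ)) * (starRingEnd ℂ) (∫ x, w x * (Real.sinh (x / 2) : ℂ))
          + (∑ n ∈ weilPrimeIndex a, (((ArithmeticFunction.vonMangoldt n : ℝ) / Real.sqrt n : ℝ) : ℂ) *
              ∫ x, (u (x + Real.log n) - u x) * (starRingEnd ℂ) (w (x + Real.log n) - w x))
          + (∫ t in Ioi (0 : ℝ), (weilArchDensity t : ℂ) *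
              ∫ x, (u (x + t) - u x) * (starRingEnd ℂ) (w (x + t) - w x))
          - (weilMarkovConstant a : ℂ) * ∫ x, u x * (starRingEnd ℂ) (w x)
        = (weilGroundEnergy a : ℂ) * ∫ x, u x * (starRingEnd ℂ) (w x)) →
    (∀ b₀ A : ℝ, 0 < b₀ → b₀ ≤ A → ∃ K : ℝ, ∀ (a : ℝ) (u : ℝ → ℂ), b₀ ≤ a → a ≤ A →
      IsWeilGroundState a u → ∀ᵐ x : ℝ, ‖u x‖ ≤ K) →
    ∀ b₀ A : ℝ, 0 < b₀ → b₀ ≤ A → ∃ K d₀ : ℝ, 0 < d₀ ∧ d₀ < 1 ∧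
      ∀ (a : ℝ) (u : ℝ → ℂ), b₀ ≤ a → a ≤ A → IsWeilGroundState a u →
        ∀ᵐ x : ℝ, a - d₀ < |x| → |x| < a → ‖u x‖ ^ 2 * Real.log (1 / (a - |x|)) ≤ K := by
  sorry

/-- **Stub D — the LOCALISED CUT INEQUALITY at a ground state** (size M/L; the lever of the card).  From (C1), (C2) and (EL) (rev 4: the Euler–Lagrange identity is supplied as an antecedent — Stub EL — instead of being re-derived here):
for `0 < b ≤ a`, a ground state `u` of the window `a`, and a Lipschitz cutoff `χ : ℝ → [0, 1]` vanishing on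
`|x| ≥ b` (so `χu` lives on the window `b`; `θ := 1 − χ` is the edge remnant),
`(ε(b) − ε(a)) ∫‖χu‖² ≤ ArchComm + PrimeComm + PolRem`, where
`ArchComm = ∫_{t>0} ρ(t) ∫ (χ(x+t) − χ(x))² |u(x+t)| |u(x)| dx dt`, `ρ = weilArchDensity`,
`PrimeComm = Σ_{log n < 2a} Λ(n) n^{-1/2} ∫ (χ(x+log n) − χ(x))² |u(x+log n)| |u(x)| dx`, and
`PolRem = 2|∫ θu·cosh(t/2)|² + 2|∫ u·cosh(t/2)| |∫ θ²u·cosh(t/2)| + 2|∫ u·sinh(t/2)| |∫ θ²u·sinh(t/2)|`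
(all integrals are genuinely convergent for Lipschitz `χ` and `u ∈ L²` of finite energy: near `t = 0` the arch
integrand is `≤ K²t²‖u‖₂² ρ(t)`, and it vanishes for `t > 2a`).
Proof route: `𝔅_a ≥ 0` on the form domain (C1) and `𝔅_a(u) ≤ 0` (C2) give `𝔅_a(u) = 0` and the weak
Euler–Lagrange equation `Re 𝔅_a(u, φ) = 0` for every `φ` in the form domain (the real quadratic
`s ↦ 𝔅_a(u + sφ) = 2s Re 𝔅_a(u,φ) + s² 𝔅_a(φ) ≥ 0`; bounded Lipschitz multipliers preserve finite energy:
`D_s(θu) ≤ 2D_s(u) + 2 min(K²s², 1)‖u‖²`); hence the ground-state substitution identity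
`𝔅_a(χu) = 𝔅_a(u − θu) = 𝔅_a(θu)` and, testing with `φ = θ²u`, the IMS localisation formula
`𝓔(θu) − Re 𝓔(u, θ²u) = ∫_{t>0}ρ(t)∫(θ(x+t)−θ(x))² Re(u(x+t)ū(x)) dx dt + (prime atoms)`
(pointwise identity `|pU − qV|² − Re((U−V)(p²Ū − q²V̄)) = (p−q)² Re(U V̄)` for real `p, q`; the killing term
drops out since `‖θu‖² = Re⟨u, θ²u⟩`), so `𝔅_a(θu) = Comm + [P(θu) − Re P(u, θ²u)] ≤ ArchComm + PrimeComm + PolRem`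
(`P(f,g) = 2(∫f cosh)conj(∫g cosh) − 2(∫f sinh)conj(∫ g sinh)`, drop `−2|∫θu sinh|² ≤ 0`); finally the window
change `𝔅_b(χu) = 𝔅_a(χu) + (ε(a) − ε(b))‖χu‖²` (for `f` supported in `[−b, b]` and `2b ≤ log n < 2a` the
increment `D_{log n}(f) = 2‖f‖²` cancels against `2Λ(n)n^{-1/2}` in `M_a − M_b`, so `𝓔_b − M_b‖·‖² = 𝓔_a −
M_a‖·‖²` there) and `𝔅_b(χu) ≥ 0` ((C1) at the window `b`).
Sources: Bombieri2000Weil §4 Lemma 1 / (4.2) (the variational equation); Cycon–Froese–Kirsch–Simon,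
Schrödinger Operators, Thm 3.2 (IMS localisation); tree `ConnesVanSuijlekom.abs_polar_le` (the test-function
version of the polar Cauchy–Schwarz); cards `ladder-edge-law-excision` §(3)–(4), `collar-cut-exit-time-edge-law`.
Why it might fail: it does not in substance (hand-checked identity, triage ×3); the Lean size is the polarised
form bookkeeping on the finite-energy class. -/
theorem stub_localizedCut :
    (∀ a : ℝ, 0 < a → ∀ f : ℝ → ℂ, MemLp f 2 → (∀ᵐ x : ℝ, x ∉ Icc (-a) a → f x = 0) →
      IntegrableOn (fun t ↦ weilArchDensity t * weilIncrement f t) (Ioi 0) →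
        (weilMarkovConstant a + weilGroundEnergy a) * ∫ x, ‖f x‖ ^ 2 ≤
          weilPoleForm f + weilDirichletEnergy a f) →
    (∀ (a : ℝ) (u : ℝ → ℂ), IsWeilGroundState a u →
      IntegrableOn (fun t ↦ weilArchDensity t * weilIncrement u t) (Ioi 0) ∧
        weilPoleForm u + weilDirichletEnergy a u ≤
          (weilMarkovConstant a + weilGroundEnergy a) * ∫ x, ‖u x‖ ^ 2) →
    (∀ (a : ℝ) (u : ℝ → ℂ), IsWeilGroundState a u →
      ∀ w : ℝ → ℂ, MemLp w 2 → (∀ᵐ x : ℝ, x ∉ Icc (-a) a → w x = 0) →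
        IntegrableOn (fun t ↦ weilArchDensity t * weilIncrement w t) (Ioi 0) →
        2 * (∫ x, u x * (Real.cosh (x / 2) : ℂ)) * (starRingEnd ℂ) (∫ x, w x * (Real.cosh (x / 2) : ℂ))
          - 2 * (∫ x, u x * (Real.sinh (x / 2) : ℂ)) * (starRingEnd ℂ) (∫ x, w x * (Real.sinh (x / 2) : ℂ))
          + (∑ n ∈ weilPrimeIndex a, (((ArithmeticFunction.vonMangoldt n : ℝ) / Real.sqrt n : ℝ) : ℂ) *
              ∫ x, (u (x + Real.log n) - u x) * (starRingEnd ℂ) (w (x + Real.log n) - w x))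
          + (∫ t in Ioi (0 : ℝ), (weilArchDensity t : ℂ) *
              ∫ x, (u (x + t) - u x) * (starRingEnd ℂ) (w (x + t) - w x))
          - (weilMarkovConstant a : ℂ) * ∫ x, u x * (starRingEnd ℂ) (w x)
        = (weilGroundEnergy a : ℂ) * ∫ x, u x * (starRingEnd ℂ) (w x)) →
    ∀ (a b : ℝ) (K : ℝ≥0) (u : ℝ → ℂ) (χ : ℝ → ℝ), 0 < b → b ≤ a → IsWeilGroundState a u →
        LipschitzWith K χ → (∀ x, 0 ≤ χ x ∧ χ x ≤ 1) → (∀ x, b ≤ |x| → χ x = 0) →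
        (weilGroundEnergy b - weilGroundEnergy a) * ∫ x, ‖(χ x : ℂ) * u x‖ ^ 2 ≤
          (∫ t in Ioi (0 : ℝ), weilArchDensity t *
              ∫ x, (χ (x + t) - χ x) ^ 2 * (‖u (x + t)‖ * ‖u x‖)) +
          (∑ n ∈ weilPrimeIndex a, (ArithmeticFunction.vonMangoldt n : ℝ) / Real.sqrt n *
              ∫ x, (χ (x + Real.log n) - χ x) ^ 2 * (‖u (x + Real.log n)‖ * ‖u x‖)) +
          2 * ‖∫ t, ((1 - χ t : ℝ) : ℂ) * u t * (Real.cosh (t / 2) : ℂ)‖ ^ 2 +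
          2 * ‖∫ t, u t * (Real.cosh (t / 2) : ℂ)‖ *
              ‖∫ t, (((1 - χ t) ^ 2 : ℝ) : ℂ) * u t * (Real.cosh (t / 2) : ℂ)‖ +
          2 * ‖∫ t, u t * (Real.sinh (t / 2) : ℂ)‖ *
              ‖∫ t, (((1 - χ t) ^ 2 : ℝ) : ℂ) * u t * (Real.sinh (t / 2) : ℂ)‖ := by
  sorry

/-- **Stub E — the commutator bound** (size M/L; hard analysis only, no functional analysis, no `ε`).  From the
sup bound (A) and the `L²` edge-mass law (B): on every compact window range `[b₀, A]` there are `C, h₀ > 0` such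
that for every window `a ∈ [b₀, A]`, every width `0 < h ≤ h₀`, every ground state `u` of the window `a` and every
ADMISSIBLE CUTOFF `χ` (values in `[0,1]`, `= 1` on `|x| ≤ a − 2h`, `= 0` on `|x| ≥ a − h`, slope `≤ 1/h`) the
right-hand side of Stub D is `≤ C h`, and `∫‖χu‖² ≥ 1/2`.
Proof route (write `m(r)² := ∫_{a−r<|x|}‖u‖² ≤ K r/log(1/r)` for `r ≤ d₀`, `L := {a − 2h < |x| < a}` the layer; a
nonzero term needs one point in `L`, since off the window `u = 0` a.e., `IsWeilGroundState.ae_eq_zero_of_notMem`):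
(I) the partner within `4h` of the same edge: `(χ(x+t) − χ(x))² ≤ min(1, t²/h²)` and
`∫₀^{4h} min(1,t²/h²) ρ(t) dt ≤ 1/2 + log 4` (`ρ(t) ≤ 1/t` on `(0, ∞)`), so by Schur's test this part is
`≤ 2 m(4h)² = O(K h / log(1/h))`;
(II) one point `x ∈ L`, the partner `y` deeper than `4h` on the same side: `≤ ∫_L |u| · sup_{x∈L} Π(x)` with
`∫_L|u| ≤ |L|^{1/2} m(2h) ≤ (4h)^{1/2}(2Kh/log(1/2h))^{1/2} = O(h (K/log(1/h))^{1/2})` (Cauchy–Schwarz, (B)) and,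
splitting the bulk into dyadic shells `S_j = {2^j h ≤ a − |y| < 2^{j+1}h}`, `2 ≤ j ≤ J` (`2^{J+1}h ≈ d₀`), on which
`|x − y| ≥ 2^{j−1}h` and `ρ(|x−y|) ≤ ρ(2^{j−1}h) ≤ 1/(2^{j−1}h)`,
`Π(x) := ∫_{a−|y|>4h} |u(y)| ρ(|x−y|) dy ≤ Σ_j (2^{j−1}h)^{-1} |S_j|^{1/2} m(2^{j+1}h) + ρ(d₀/2)‖u‖₁
 ≤ Σ_j 2(2K)^{1/2} (log(1/(2^{j+1}h)))^{-1/2} + O(1) = O((K log(1/h))^{1/2})`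
(the sum is `≍ ∫_{O(1)}^{log(1/h)} s^{-1/2} ds`; Cauchy–Schwarz SHELL BY SHELL — a global Cauchy–Schwarz would lose
`(log log(1/h))^{1/2}` here): product `O(K h)`;
(III) partner on the opposite side: `|x − y| ≥ a − 2h ≥ b₀/2`, `ρ ≤ ρ(b₀/2)`, contributes `O(h (log 1/h)^{-1/2})`;
primes: `(χ(x+log n) − χ(x))² ≠ 0` with both values of `u` nonzero forces `x` or `x + log n` into `L`, and the
partner lies in a strip of width `4h`, so by (A) each term is
`≤ Λ(n)n^{-1/2} · m(2h) · (4h ‖u‖²_∞)^{1/2} · 2 = O(h (log 1/h)^{-1/2})`;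
pole terms: `|∫ θu cosh| ≤ cosh(A/2) ∫_L |u| = O(h (log 1/h)^{-1/2})`, `|∫ u cosh| ≤ cosh(A/2)(2A)^{1/2}`.
Mass: `∫‖χu‖² ≥ ∫_{|x| ≤ a−2h}‖u‖² = 1 − m(2h)² ≥ 1 − 4Kh/log(1/2h) ≥ 1/2` (`∫|u|² = 1`,
`IsWeilGroundState.integral_norm_sq`).  Take `h₀ ≤ min(d₀/16, b₀/4, e^{-2})`.  The floor `0 < b₀` enters through
(A), (B) and (III).  Numerics: kit j005651 — `cut-cost/h` flat over six decades of `h` (a = 0.25: 1.155 → 0.998 vs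
true drop/h → 0.81; a = 0.36: 0.037 vs 0.030).  Why it might fail: only if (B) is false (then `h (log 1/h)^{1−2τ}`);
the shell bookkeeping was done by hand in the line card (§Triage answers). -/
theorem stub_commutatorBound :
    (∀ b₀ A : ℝ, 0 < b₀ → b₀ ≤ A → ∃ K : ℝ, ∀ (a : ℝ) (u : ℝ → ℂ), b₀ ≤ a → a ≤ A →
      IsWeilGroundState a u → ∀ᵐ x : ℝ, ‖u x‖ ≤ K) →
    (∀ b₀ A : ℝ, 0 < b₀ → b₀ ≤ A → ∃ K d₀ : ℝ, 0 < d₀ ∧ d₀ < 1 ∧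
      ∀ (a r : ℝ) (u : ℝ → ℂ), b₀ ≤ a → a ≤ A → IsWeilGroundState a u → 0 < r → r ≤ d₀ →
        ∫ x in {x : ℝ | a - r < |x|}, ‖u x‖ ^ 2 ≤ K * r / Real.log (1 / r)) →
    ∀ b₀ A : ℝ, 0 < b₀ → b₀ ≤ A → ∃ C h₀ : ℝ, 0 < h₀ ∧
        ∀ (a h : ℝ) (u : ℝ → ℂ) (χ : ℝ → ℝ), b₀ ≤ a → a ≤ A → 0 < h → h ≤ h₀ →
        IsWeilGroundState a u → (∀ x y, |χ x - χ y| ≤ |x - y| / h) → (∀ x, 0 ≤ χ x ∧ χ x ≤ 1) →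
        (∀ x, |x| ≤ a - 2 * h → χ x = 1) → (∀ x, a - h ≤ |x| → χ x = 0) →
        (∫ t in Ioi (0 : ℝ), weilArchDensity t *
              ∫ x, (χ (x + t) - χ x) ^ 2 * (‖u (x + t)‖ * ‖u x‖)) +
          (∑ n ∈ weilPrimeIndex a, (ArithmeticFunction.vonMangoldt n : ℝ) / Real.sqrt n *
              ∫ x, (χ (x + Real.log n) - χ x) ^ 2 * (‖u (x + Real.log n)‖ * ‖u x‖)) +
          2 * ‖∫ t, ((1 - χ t : ℝ) : ℂ) * u t * (Real.cosh (t / 2) : ℂ)‖ ^ 2 +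
          2 * ‖∫ t, u t * (Real.cosh (t / 2) : ℂ)‖ *
              ‖∫ t, (((1 - χ t) ^ 2 : ℝ) : ℂ) * u t * (Real.cosh (t / 2) : ℂ)‖ +
          2 * ‖∫ t, u t * (Real.sinh (t / 2) : ℂ)‖ *
              ‖∫ t, (((1 - χ t) ^ 2 : ℝ) : ℂ) * u t * (Real.sinh (t / 2) : ℂ)‖ ≤ C * h ∧
          1 / 2 ≤ ∫ x, ‖(χ x : ℂ) * u x‖ ^ 2 := by
  sorry

/-! ### Bridge to the pointwise edge law (sorry-free; NOT a stub) -/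

/-- **The pointwise edge law implies the edge-mass law (Stub B's conclusion).**  If on `[b₀, A]` every ground
state satisfies `‖u(x)‖² · log(1/(a − |x|)) ≤ K` for a.e. `x` with `a − d₀ < |x| < a` (the `C⁺` of the sibling
lines `ladder-height-edge-law` (`stub_exitTime`/`stub_cut`) and rev 2 of this line; `borderline-barrier`'s
`log(4A/(a−|x|))` variant implies it), then `∫_{a−r<|x|} ‖u‖² ≤ 2 max(K,0) · r / log(1/r)` for `0 < r ≤ d₀`:
`u = 0` a.e. off `[−a, a]` (`IsWeilGroundState.ae_eq_zero_of_notMem`), the layer `{a − r < |x| ≤ a}` has measure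
`2r`, and on it `log(1/(a−|x|)) ≥ log(1/r) > 0`.  So a worker holding ANY pointwise engine discharges Stub B by
`exact edgeMassLaw_of_pointwise h`. -/
theorem edgeMassLaw_of_pointwise
    (hP : ∀ b₀ A : ℝ, 0 < b₀ → b₀ ≤ A → ∃ K d₀ : ℝ, 0 < d₀ ∧ d₀ < 1 ∧
      ∀ (a : ℝ) (u : ℝ → ℂ), b₀ ≤ a → a ≤ A → IsWeilGroundState a u →
        ∀ᵐ x : ℝ, a - d₀ < |x| → |x| < a → ‖u x‖ ^ 2 * Real.log (1 / (a - |x|)) ≤ K) :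
    ∀ b₀ A : ℝ, 0 < b₀ → b₀ ≤ A → ∃ K d₀ : ℝ, 0 < d₀ ∧ d₀ < 1 ∧
      ∀ (a r : ℝ) (u : ℝ → ℂ), b₀ ≤ a → a ≤ A → IsWeilGroundState a u → 0 < r → r ≤ d₀ →
        ∫ x in {x : ℝ | a - r < |x|}, ‖u x‖ ^ 2 ≤ K * r / Real.log (1 / r) := by
  intro b₀ A hb₀ hb₀A
  obtain ⟨K, d₀, hd₀, hd₀1, hK⟩ := hP b₀ A hb₀ hb₀A
  refine ⟨2 * max K 0, d₀, hd₀, hd₀1, ?_⟩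
  intro a r u ha haA hu hr hrd
  have hr1 : r < 1 := lt_of_le_of_lt hrd hd₀1
  have hlogr : 0 < Real.log (1 / r) := by
    apply Real.log_pos
    rw [lt_div_iff₀ hr, one_mul]
    exact hr1
  have hc0 : 0 ≤ max K 0 / Real.log (1 / r) := div_nonneg (le_max_right _ _) hlogr.le
  have hSm : MeasurableSet {x : ℝ | a - r < |x|} :=
    (isOpen_lt continuous_const continuous_abs).measurableSet
  -- Step 1: the integral over the (infinite-measure) set is the integral over its trace on the window
  have hind : ∀ᵐ x : ℝ, ‖u x‖ ^ 2 = (Icc (-a) a).indicator (fun x ↦ ‖u x‖ ^ 2) x := by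
    filter_upwards [hu.ae_eq_zero_of_notMem] with x hx
    by_cases hm : x ∈ Icc (-a) a
    · simp [hm]
    · simp [hm, hx hm]
  have hST : ∫ x in {x : ℝ | a - r < |x|}, ‖u x‖ ^ 2 =
      ∫ x in {x : ℝ | a - r < |x|} ∩ Icc (-a) a, ‖u x‖ ^ 2 := by
    rw [integral_congr_ae (ae_restrict_of_ae hind), setIntegral_indicator measurableSet_Icc]
  -- Step 2: the trace has measure at most `2r`
  have hTsub : {x : ℝ | a - r < |x|} ∩ Icc (-a) a ⊆ Icc (a - r) a ∪ Icc (-a) (-(a - r)) := by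
    intro x hx
    obtain ⟨hxS, hxI⟩ := hx
    simp only [mem_setOf_eq] at hxS
    rcases le_or_gt 0 x with h0 | h0
    · left
      rw [abs_of_nonneg h0] at hxS
      exact ⟨hxS.le, hxI.2⟩
    · right
      rw [abs_of_neg h0] at hxS
      exact ⟨hxI.1, by linarith⟩
  have hUfin : volume (Icc (a - r) a ∪ Icc (-a) (-(a - r))) < ∞ :=
    lt_of_le_of_lt (measure_union_le _ _)
      (by simp [Real.volume_Icc] : volume (Icc (a - r) a) + volume (Icc (-a) (-(a - r))) < ∞)
  have hTfin : volume ({x : ℝ | a - r < |x|} ∩ Icc (-a) a) < ∞ := (measure_mono hTsub).trans_lt hUfin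
  have hTreal : volume.real ({x : ℝ | a - r < |x|} ∩ Icc (-a) a) ≤ 2 * r := by
    calc volume.real ({x : ℝ | a - r < |x|} ∩ Icc (-a) a)
        ≤ volume.real (Icc (a - r) a ∪ Icc (-a) (-(a - r))) := measureReal_mono hTsub hUfin.ne
      _ ≤ volume.real (Icc (a - r) a) + volume.real (Icc (-a) (-(a - r))) := measureReal_union_le _ _
      _ = r + r := by
          rw [Real.volume_real_Icc_of_le (by linarith), Real.volume_real_Icc_of_le (by linarith)]
          ring
      _ = 2 * r := by ring
  -- Step 3: a.e. on the trace, `‖u x‖² ≤ max K 0 / log(1/r)`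
  have hbd : ∀ᵐ x : ℝ, x ∈ {x : ℝ | a - r < |x|} ∩ Icc (-a) a →
      ‖(‖u x‖ ^ 2 : ℝ)‖ ≤ max K 0 / Real.log (1 / r) := by
    filter_upwards [hK a u ha haA hu, Measure.ae_ne volume a, Measure.ae_ne volume (-a)]
      with x hx hxa hxna
    intro hxT
    obtain ⟨hxS, hxI⟩ := hxT
    simp only [mem_setOf_eq] at hxS
    rw [Real.norm_of_nonneg (by positivity)]
    have hxa' : |x| < a := by
      rcases (abs_le.2 ⟨hxI.1, hxI.2⟩).lt_or_eq with hlt | heq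
      · exact hlt
      · exfalso
        rcases le_or_gt 0 x with h0 | h0
        · rw [abs_of_nonneg h0] at heq
          exact hxa heq
        · rw [abs_of_neg h0] at heq
          exact hxna (by linarith)
    have hd : 0 < a - |x| := sub_pos.2 hxa'
    have hdr : a - |x| < r := by linarith
    have hlogx : Real.log (1 / r) ≤ Real.log (1 / (a - |x|)) :=
      Real.log_le_log (by positivity) (one_div_le_one_div_of_le hd hdr.le)
    have hlogx0 : 0 < Real.log (1 / (a - |x|)) := hlogr.trans_le hlogx
    have h1 : ‖u x‖ ^ 2 * Real.log (1 / (a - |x|)) ≤ K := hx (by linarith) hxa'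
    have h2 : ‖u x‖ ^ 2 * Real.log (1 / (a - |x|)) ≤ max K 0 := h1.trans (le_max_left _ _)
    calc ‖u x‖ ^ 2 ≤ max K 0 / Real.log (1 / (a - |x|)) := by
          rw [le_div_iff₀ hlogx0]
          exact h2
      _ ≤ max K 0 / Real.log (1 / r) :=
          div_le_div_of_nonneg_left (le_max_right _ _) hlogr hlogx
  -- Step 4: assemble
  have hnorm := norm_setIntegral_le_of_norm_le_const_ae' hTfin hbd
  rw [hST]
  calc ∫ x in {x : ℝ | a - r < |x|} ∩ Icc (-a) a, ‖u x‖ ^ 2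
      ≤ ‖∫ x in {x : ℝ | a - r < |x|} ∩ Icc (-a) a, ‖u x‖ ^ 2‖ := Real.le_norm_self _
    _ ≤ max K 0 / Real.log (1 / r) * volume.real ({x : ℝ | a - r < |x|} ∩ Icc (-a) a) := hnorm
    _ ≤ max K 0 / Real.log (1 / r) * (2 * r) := mul_le_mul_of_nonneg_left hTreal hc0
    _ = 2 * max K 0 * r / Real.log (1 / r) := by ring


/-! ### Sorry-free glue -/

/-- Antitonicity of the window bottom: a larger window has a smaller bottom (`sInf` over a larger, still
bounded-below set; the smaller sphere is nonempty).  Proved here so that the composition below is sorry-free;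
the disprover's `weilGroundEnergy_antitone` (Disproof.lean) is the same statement. -/
theorem weilGroundEnergy_antitone {a b : ℝ} (hb : 0 < b) (hba : b ≤ a) :
    weilGroundEnergy a ≤ weilGroundEnergy b := by
  obtain ⟨g, hg, hs, hn⟩ := exists_isWeilTest_sphere hb
  refine le_csInf ⟨_, g, hg, hs, hn, rfl⟩ ?_
  rintro x ⟨h, hh, hhs, hhn, rfl⟩
  exact csInf_le (bddBelow_weilQuadratic_sphere_holds a)
    ⟨h, hh, hhs.trans (Icc_subset_Icc (neg_le_neg hba) hba), hhn, rfl⟩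

/-- **The one-step bound from the statements of (D) and (E)** (sorry-free; hypotheses are the stub STATEMENTS,
conclusion is NOT the crux).  For `a ∈ [b₀, A]` and `0 < h ≤ h₁ := min h₀ (b₀/2)` take a ground state `u` of the
window `a` (`ConnesConsaniMoscovici2025_thm_3_6_holds.exists_isWeilGroundState`, PROVED in the tree) and the
piecewise-linear cutoff `χ(x) = max (min ((a − h − |x|)/h) 1) 0`; (D) at `b = a − h` and (E) give
`(ε(a−h) − ε(a)) · ∫‖χu‖² ≤ C h` with `∫‖χu‖² ≥ 1/2`, and `ε(a−h) ≥ ε(a)` (antitone), so `ε(a−h) − ε(a) ≤ 2Ch`. -/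
theorem oneStep_of
    (hD : (∀ (a b : ℝ) (K : ℝ≥0) (u : ℝ → ℂ) (χ : ℝ → ℝ), 0 < b → b ≤ a → IsWeilGroundState a u →
        LipschitzWith K χ → (∀ x, 0 ≤ χ x ∧ χ x ≤ 1) → (∀ x, b ≤ |x| → χ x = 0) →
        (weilGroundEnergy b - weilGroundEnergy a) * ∫ x, ‖(χ x : ℂ) * u x‖ ^ 2 ≤
          (∫ t in Ioi (0 : ℝ), weilArchDensity t *
              ∫ x, (χ (x + t) - χ x) ^ 2 * (‖u (x + t)‖ * ‖u x‖)) +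
          (∑ n ∈ weilPrimeIndex a, (ArithmeticFunction.vonMangoldt n : ℝ) / Real.sqrt n *
              ∫ x, (χ (x + Real.log n) - χ x) ^ 2 * (‖u (x + Real.log n)‖ * ‖u x‖)) +
          2 * ‖∫ t, ((1 - χ t : ℝ) : ℂ) * u t * (Real.cosh (t / 2) : ℂ)‖ ^ 2 +
          2 * ‖∫ t, u t * (Real.cosh (t / 2) : ℂ)‖ *
              ‖∫ t, (((1 - χ t) ^ 2 : ℝ) : ℂ) * u t * (Real.cosh (t / 2) : ℂ)‖ +
          2 * ‖∫ t, u t * (Real.sinh (t / 2) : ℂ)‖ *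
              ‖∫ t, (((1 - χ t) ^ 2 : ℝ) : ℂ) * u t * (Real.sinh (t / 2) : ℂ)‖))
    (hEst : (∀ b₀ A : ℝ, 0 < b₀ → b₀ ≤ A → ∃ C h₀ : ℝ, 0 < h₀ ∧
        ∀ (a h : ℝ) (u : ℝ → ℂ) (χ : ℝ → ℝ), b₀ ≤ a → a ≤ A → 0 < h → h ≤ h₀ →
        IsWeilGroundState a u → (∀ x y, |χ x - χ y| ≤ |x - y| / h) → (∀ x, 0 ≤ χ x ∧ χ x ≤ 1) →
        (∀ x, |x| ≤ a - 2 * h → χ x = 1) → (∀ x, a - h ≤ |x| → χ x = 0) →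
        (∫ t in Ioi (0 : ℝ), weilArchDensity t *
              ∫ x, (χ (x + t) - χ x) ^ 2 * (‖u (x + t)‖ * ‖u x‖)) +
          (∑ n ∈ weilPrimeIndex a, (ArithmeticFunction.vonMangoldt n : ℝ) / Real.sqrt n *
              ∫ x, (χ (x + Real.log n) - χ x) ^ 2 * (‖u (x + Real.log n)‖ * ‖u x‖)) +
          2 * ‖∫ t, ((1 - χ t : ℝ) : ℂ) * u t * (Real.cosh (t / 2) : ℂ)‖ ^ 2 +
          2 * ‖∫ t, u t * (Real.cosh (t / 2) : ℂ)‖ *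
              ‖∫ t, (((1 - χ t) ^ 2 : ℝ) : ℂ) * u t * (Real.cosh (t / 2) : ℂ)‖ +
          2 * ‖∫ t, u t * (Real.sinh (t / 2) : ℂ)‖ *
              ‖∫ t, (((1 - χ t) ^ 2 : ℝ) : ℂ) * u t * (Real.sinh (t / 2) : ℂ)‖ ≤ C * h ∧
          1 / 2 ≤ ∫ x, ‖(χ x : ℂ) * u x‖ ^ 2)) :
    ∀ b₀ A : ℝ, 0 < b₀ → b₀ ≤ A → ∃ C h₁ : ℝ, 0 < h₁ ∧ h₁ ≤ b₀ / 2 ∧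
      ∀ a h : ℝ, b₀ ≤ a → a ≤ A → 0 < h → h ≤ h₁ →
        weilGroundEnergy (a - h) - weilGroundEnergy a ≤ C * h := by
  intro b₀ A hb₀ hb₀A
  obtain ⟨C, h₀, hh₀, hest⟩ := hEst b₀ A hb₀ hb₀A
  -- shrink the admissible width so that the small window `a - h` stays positive (the floor `0 < b₀` is used here)
  set h₁ : ℝ := min h₀ (b₀ / 2) with hh₁def
  have hh₁ : 0 < h₁ := lt_min hh₀ (by linarith)
  have hh₁₀ : h₁ ≤ h₀ := min_le_left _ _
  have hh₁b : h₁ ≤ b₀ / 2 := min_le_right _ _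
  refine ⟨2 * max C 0, h₁, hh₁, hh₁b, ?_⟩
  intro a h ha haA hh hhle
  have ha0 : 0 < a := lt_of_lt_of_le hb₀ ha
  have hb : 0 < a - h := by linarith
  obtain ⟨u, hu⟩ := ConnesConsaniMoscovici2025_thm_3_6_holds.exists_isWeilGroundState ha0
  -- the piecewise-linear cutoff of width `h`
  set χ : ℝ → ℝ := fun x ↦ max (min ((a - h - |x|) / h) 1) 0 with hχdef
  have hχ01 : ∀ x, 0 ≤ χ x ∧ χ x ≤ 1 := fun x ↦
    ⟨le_max_right _ _, max_le (min_le_right _ _) zero_le_one⟩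
  have hχone : ∀ x, |x| ≤ a - 2 * h → χ x = 1 := by
    intro x hx
    have h1p : 1 ≤ (a - h - |x|) / h := by
      rw [le_div_iff₀ hh]
      linarith
    show max (min ((a - h - |x|) / h) 1) 0 = 1
    rw [min_eq_right h1p, max_eq_left (zero_le_one' ℝ)]
  have hχzero : ∀ x, a - h ≤ |x| → χ x = 0 := by
    intro x hx
    have hp : (a - h - |x|) / h ≤ 0 := by
      rw [div_le_iff₀ hh, zero_mul]
      linarith
    show max (min ((a - h - |x|) / h) 1) 0 = 0
    exact max_eq_right ((min_le_left _ _).trans hp)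
  have hχlip : ∀ x y, |χ x - χ y| ≤ |x - y| / h := by
    intro x y
    calc |χ x - χ y|
        = |max (min ((a - h - |x|) / h) 1) 0 - max (min ((a - h - |y|) / h) 1) 0| := rfl
      _ ≤ |min ((a - h - |x|) / h) 1 - min ((a - h - |y|) / h) 1| := abs_max_sub_max_le_abs _ _ _
      _ ≤ max |(a - h - |x|) / h - (a - h - |y|) / h| |(1 : ℝ) - 1| := abs_min_sub_min_le_max _ _ _ _
      _ = |(a - h - |x|) / h - (a - h - |y|) / h| := by
          rw [sub_self, abs_zero, max_eq_left (abs_nonneg _)]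
      _ = |(|y| - |x|)| / h := by
          rw [show (a - h - |x|) / h - (a - h - |y|) / h = (|y| - |x|) / h by ring, abs_div,
            abs_of_pos hh]
      _ ≤ |x - y| / h := by
          rw [div_le_div_iff_of_pos_right hh, abs_sub_comm x y]
          exact abs_abs_sub_abs_le_abs_sub y x
  have hχLW : LipschitzWith (Real.toNNReal (1 / h)) χ := by
    refine LipschitzWith.of_dist_le_mul fun x y ↦ ?_
    rw [Real.dist_eq, Real.dist_eq, Real.coe_toNNReal _ (by positivity)]
    calc |χ x - χ y| ≤ |x - y| / h := hχlip x y
      _ = 1 / h * |x - y| := by ring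
  -- (D) at `b = a - h` and (E)
  have hcut := hD a (a - h) (Real.toNNReal (1 / h)) u χ hb (by linarith) hu hχLW hχ01 hχzero
  obtain ⟨hR, hm⟩ := hest a h u χ ha haA hh (hhle.trans hh₁₀) hu hχlip hχ01 hχone hχzero
  have hanti : 0 ≤ weilGroundEnergy (a - h) - weilGroundEnergy a :=
    sub_nonneg.2 (weilGroundEnergy_antitone hb (by linarith))
  have h1 : (weilGroundEnergy (a - h) - weilGroundEnergy a) * (1 / 2) ≤ C * h :=
    le_trans (mul_le_mul_of_nonneg_left hm hanti) (hcut.trans hR)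
  have h2 : C * h ≤ max C 0 * h := mul_le_mul_of_nonneg_right (le_max_left C 0) hh.le
  linarith

/-- **Local-to-compact glue** (sorry-free; the "local-to-compact is free" step of the disprover's
`windowLipschitz_iff_locallyLipschitzOn`): a one-step bound `ε(a−h) − ε(a) ≤ C h` for `0 < h ≤ h₁` on `[b₀, A]`
gives the Lipschitz bound with `L := max C 0 + |ε(b₀) − ε(A)|/h₁`; gaps `a − b > h₁` are paid by antitonicity,
`ε(b) − ε(a) ≤ ε(b₀) − ε(A) ≤ |ε(b₀) − ε(A)|/h₁ · (a − b)`. -/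
theorem lipschitzBound_of_oneStep {b₀ A C h₁ : ℝ} (hb₀ : 0 < b₀) (hh₁ : 0 < h₁)
    (hstep : ∀ a h : ℝ, b₀ ≤ a → a ≤ A → 0 < h → h ≤ h₁ →
      weilGroundEnergy (a - h) - weilGroundEnergy a ≤ C * h) :
    ∃ L : ℝ, ∀ b a : ℝ, b₀ ≤ b → b ≤ a → a ≤ A →
      weilGroundEnergy b - weilGroundEnergy a ≤ L * (a - b) := by
  set M : ℝ := |weilGroundEnergy b₀ - weilGroundEnergy A| with hM
  have hM0 : 0 ≤ M := abs_nonneg _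
  have hMh : 0 ≤ M / h₁ := div_nonneg hM0 hh₁.le
  refine ⟨max C 0 + M / h₁, ?_⟩
  intro b a hb hba haA
  have hb0 : 0 < b := lt_of_lt_of_le hb₀ hb
  have ha0 : 0 < a := lt_of_lt_of_le hb0 hba
  rcases eq_or_lt_of_le hba with heq | hlt
  · subst heq
    simp
  · by_cases hsmall : a - b ≤ h₁
    · have hpos : 0 < a - b := sub_pos.2 hlt
      have h1 := hstep a (a - b) (le_trans hb hba) haA hpos hsmall
      rw [sub_sub_cancel] at h1
      calc weilGroundEnergy b - weilGroundEnergy a ≤ C * (a - b) := h1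
        _ ≤ (max C 0 + M / h₁) * (a - b) := by
            apply mul_le_mul_of_nonneg_right _ hpos.le
            linarith [le_max_left C 0]
    · have hlarge : h₁ < a - b := lt_of_not_ge hsmall
      have e1 : weilGroundEnergy b ≤ weilGroundEnergy b₀ := weilGroundEnergy_antitone hb₀ hb
      have e2 : weilGroundEnergy A ≤ weilGroundEnergy a := weilGroundEnergy_antitone ha0 haA
      have h2 : weilGroundEnergy b - weilGroundEnergy a ≤ M :=
        le_trans (by linarith) (le_abs_self _)
      calc weilGroundEnergy b - weilGroundEnergy a ≤ M := h2
        _ = (M / h₁) * h₁ := by field_simp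
        _ ≤ (M / h₁) * (a - b) := mul_le_mul_of_nonneg_left hlarge.le hMh
        _ ≤ (max C 0 + M / h₁) * (a - b) := by
            apply mul_le_mul_of_nonneg_right _ (sub_nonneg.2 hba)
            linarith [le_max_right C 0]

/-! ### The composition (concludes the crux BY NAME; the seven stubs enter BY NAME) -/

/-- **`WindowLipschitz` from the seven registered stubs** — the skeleton's crux proof term:
(C1) `stub_formDomainPos`, (C2) `stub_groundStateEnergy`, (EL) `stub_eulerLagrange C1 C2`, (A) `stub_supBound C2 EL`,
(P) `stub_edgeLaw C2 EL A`, (B) `edgeMassLaw_of_pointwise P` (sorry-free bridge), (D) `stub_localizedCut C1 C2 EL`,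
(E) `stub_commutatorBound A B` feed `oneStep_of`, and `lipschitzBound_of_oneStep` is the local-to-compact glue.
No hypotheses; `sorry` only inside the seven `stub_*`. -/
theorem WindowLipschitz_of : WindowLipschitz := by
  have hC1 := stub_formDomainPos
  have hC2 := stub_groundStateEnergy
  have hEL := stub_eulerLagrange hC1 hC2
  have hA := stub_supBound hC2 hEL
  have hP := stub_edgeLaw hC2 hEL hA
  have hB := edgeMassLaw_of_pointwise hP
  have hD := stub_localizedCut hC1 hC2 hEL
  have hE := stub_commutatorBound hA hB
  intro b₀ A hb₀ hb₀A
  obtain ⟨C, h₁, hh₁, -, hstep⟩ := oneStep_of hD hE b₀ A hb₀ hb₀A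
  exact lipschitzBound_of_oneStep hb₀ hh₁ hstep

end Summit.RiemannHypothesis.RiemannHypothesis.Cruxes.WindowLipschitz.CutDontSqueeze

end
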